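import Literature.NumberTheory.Sieve.PolymathFormsMaynard
import HarnessLib

/-!
# A narrow admissible 53-tuple (`H(53) ≤ 264`) and the sentence «`M₅₃ > 4 ⇒ H₁ ≤ 264`»

Topic `Literature/NumberTheory/Sieve`.  Polymath 8b, §9 item 1 (p. 37): "Extrapolation of existing numerics
also raises the possibility that `M_{53}` exceeds `4`, in which case the bound of `270` in
Theorem 1.4(vii) could be lowered to `264`."  This file supplies the two non-variational ingredients of
that sentence, so that an exact certificate for `M_{53} > 4` (two rational numbers, see
`PolymathFormsMaynard.lean`) closes it in one line:

* `narrowTuple53` — an admissible 53-tuple of diameter `264`, reproduced verbatim from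
  A. V. Sutherland's database of narrow admissible tuples (Polymath8), file `admissible_53_264.txt`
  (53 integers `0, 10, 12, …, 262, 264`; retrieved 2026-08-26), with `card_narrowTuple53`,
  `narrowTuple53_mem_Icc`, `narrowTuple53_exists_forall_not_dvd` (a missed residue class modulo every
  `2 ≤ p ≤ 53`, by kernel decision) and `isAdmissibleTuple_narrowTuple53` (`H(53) ≤ 264`) — the pattern of
  `narrowTuple50` in `PolymathBoundedGaps.lean`;
* `frequently_nth_prime_succ_le_add_264_of_weakDHL : DHL[53, 2] → p_{n+1} ≤ p_n + 264` infinitely often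
  (Polymath 8b §3, p. 8: `DHL[k, m+1] ⇒ H_m ≤ H(k)`);
* `MkEps.frequently_nth_prime_succ_le_add_264_of_forms` — **the landing pad**: if power-sum-product data
  `(v, D, A, ν)` at `k = 53` has `0 < iForm` and `4 · iForm < 53 · jForm` (i.e. certifies `M_{53} > 4` via
  `MkEps.lt_maynardFunctional_of_forms`), then `liminf (p_{n+1} - p_n) ≤ 264`, unconditionally
  (`MkEps.weakDHL_of_forms`: Maynard's theorem and Bombieri–Vinogradov are the tree's theorems).

NOT here: any certificate (whether `M_{53} > 4` holds is OPEN — Polymath 8b §7.1, the Krylov table labelled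
`tab` ("Selected lower bounds on `M_k` obtained from the Krylov subspace method, with the `k/(k-1) log k`
upper bound"), row `k = 53`: `3.98621 ≤ M_{53} ≤ 4.04665`);
optimality of `264` (the database value; Polymath 8b §10.2 (p. 39): "exact values for `H(k)` are known only for
`k ≤ 342`" — which covers `k = 53` — not used here).

## References

* D. H. J. Polymath, *Variants of the Selberg sieve, and bounded intervals containing many primes*,
  Res. Math. Sci. 1 (2014), Art. 12 = arXiv:1407.4897, §9 item 1 (p. 37), §3 (p. 8), §10. [Polymath8b2014]
* A. V. Sutherland, *Narrow admissible tuples* (database), https://math.mit.edu/~primegaps/,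
  file `admissible_53_264.txt`. [SutherlandNarrowAdmissibleTuples]
-/

open Filter Finset

namespace Literature.NumberTheory.Sieve

/-! ### The tuple -/

/-- An admissible 53-tuple of diameter `264` (Sutherland's database, file `admissible_53_264.txt`,
verbatim), witnessing `H(53) ≤ 264` — the value `264` of Polymath 8b §9 item 1 (p. 37).
[cite: SutherlandNarrowAdmissibleTuples, file admissible_53_264.txt][cite: Polymath8b2014, §9 item 1 (p. 37)] -/
def narrowTuple53 : Finset ℤ :=
  {0, 10, 12, 16, 22, 24, 30, 36, 42, 52, 54, 60, 64, 66, 70, 82, 94, 96, 100, 102, 112, 114, 120,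
    126, 130, 136, 142, 144, 154, 156, 162, 166, 180, 184, 186, 190, 192, 196, 204, 210, 214, 220,
    222, 226, 232, 234, 240, 246, 250, 252, 256, 262, 264}

/-- `narrowTuple53` has 53 elements. [cite: SutherlandNarrowAdmissibleTuples, file admissible_53_264.txt] -/
theorem card_narrowTuple53 : narrowTuple53.card = 53 := by
  decide +kernel

/-- `narrowTuple53 ⊆ [0, 264]`: its diameter is `≤ 264`. [cite: SutherlandNarrowAdmissibleTuples, file admissible_53_264.txt] -/
theorem narrowTuple53_mem_Icc : ∀ h ∈ narrowTuple53, (0 : ℤ) ≤ h ∧ h ≤ 264 := by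
  decide +kernel

/-- `0 ∈ narrowTuple53` and `264 ∈ narrowTuple53`: the diameter is exactly `264`.
[cite: SutherlandNarrowAdmissibleTuples, file admissible_53_264.txt] -/
theorem zero_mem_narrowTuple53_and : (0 : ℤ) ∈ narrowTuple53 ∧ (264 : ℤ) ∈ narrowTuple53 := by
  decide +kernel

/-- For every `2 ≤ p ≤ 53` the tuple misses some residue class `r (p)` (kernel computation; Polymath 8b
§10.2.1, admissibility testing modulo `p ≤ k`). [cite: Polymath8b2014, §10.2.1] -/
theorem narrowTuple53_exists_forall_not_dvd :
    ∀ p ∈ Finset.Icc 2 53, ∃ r ∈ Finset.range p, ∀ h ∈ narrowTuple53, ¬((p : ℤ) ∣ h - r) := by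
  decide +kernel

/-- `narrowTuple53` is admissible, hence **`H(53) ≤ 264`**; only primes `p ≤ 53` need checking
(`isAdmissibleTuple_iff_of_le_card`). [cite: Polymath8b2014, §9 item 1 (p. 37) (the value 264) and §10.2.1] -/
theorem isAdmissibleTuple_narrowTuple53 : IsAdmissibleTuple narrowTuple53 := by
  rw [isAdmissibleTuple_iff_of_le_card, card_narrowTuple53]
  intro p hp hle
  obtain ⟨r, -, hr⟩ := narrowTuple53_exists_forall_not_dvd p (Finset.mem_Icc.2 ⟨hp.two_le, hle⟩)
  exact tupleResidueCount_lt_of_forall_not_dvd hp.pos hr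

/-- There is an admissible 53-tuple of diameter `≤ 264`. [cite: Polymath8b2014, §9 item 1 (p. 37)] -/
theorem exists_isAdmissibleTuple_card_53 :
    ∃ H : Finset ℤ, IsAdmissibleTuple H ∧ H.card = 53 ∧ ∀ a ∈ H, ∀ b ∈ H, b - a ≤ (264 : ℤ) :=
  ⟨narrowTuple53, isAdmissibleTuple_narrowTuple53, card_narrowTuple53, fun a ha b hb => by
    have h1 := narrowTuple53_mem_Icc a ha
    have h2 := narrowTuple53_mem_Icc b hb
    omega⟩

/-! ### `DHL[53, 2] ⇒ H₁ ≤ 264`, and the landing pad for an `M₅₃ > 4` certificate -/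

/-- **`DHL[53, 2]` implies `liminf (p_{n+1} - p_n) ≤ 264`** (Polymath 8b p. 8: `DHL[k, m+1] ⇒ H_m ≤ H(k)`,
with `H(53) ≤ 264`). [cite: Polymath8b2014, §3 (p. 8) and §9 item 1 (p. 37)] -/
theorem frequently_nth_prime_succ_le_add_264_of_weakDHL (h : WeakDicksonHardyLittlewood 53 2) :
    ∃ᶠ n in atTop, Nat.nth Nat.Prime (n + 1) ≤ Nat.nth Nat.Prime n + 264 :=
  h.frequently_nth_prime_add_le (m := 1) isAdmissibleTuple_narrowTuple53 card_narrowTuple53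
    (d := 264) fun a ha b hb => by
      have h1 := narrowTuple53_mem_Icc a ha
      have h2 := narrowTuple53_mem_Icc b hb
      push_cast
      omega

namespace MkEps

/-- **Landing pad for «`M₅₃ > 4 ⇒ H₁ ≤ 264`»** (Polymath 8b §9 item 1 (p. 37)): if power-sum-product data
`(v, D, A, ν)` at `k = 53` (`r = ρ = 1`, see `PolymathFormsMaynard.lean`) satisfies `0 < iForm` and
`4 · iForm < 53 · jForm` — an exact inequality between two rational numbers, certifying
`maynardFunctional 53 F > 4` for `F = 1_{R₅₃} · Q` — then `p_{n+1} - p_n ≤ 264` for infinitely many `n`,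
unconditionally. [cite: Polymath8b2014, §9 item 1 (p. 37) (with Theorem 3.8 and §3 p. 8)] -/
theorem frequently_nth_prime_succ_le_add_264_of_forms {P : ℕ} {ι : Type*} [Fintype ι]
    (v : Fin P → ℕ) (D : ℕ) (A : ι → ℕ → ℝ) (ν : ι → Fin P → ℕ)
    (hpos : 0 < iForm v 53 1 D A ν) (hlt : 4 * iForm v 53 1 D A ν < (53 : ℝ) * jForm v 52 1 1 D A ν) :
    ∃ᶠ n in atTop, Nat.nth Nat.Prime (n + 1) ≤ Nat.nth Nat.Prime n + 264 := by
  refine frequently_nth_prime_succ_le_add_264_of_weakDHL (weakDHL_of_forms 52 1 v D A ν hpos ?_)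
  simpa using hlt

end MkEps

end Literature.NumberTheory.Sieve
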